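import Literature.Combinatorics.Optimization.HexagonComplexPsdRank
import Literature.Combinatorics.Optimization.PsdRankFidelityLowerBounds
import HarnessLib

/-!
# The psd rank of the disjointness matrix, tensoring, and Hadamard square roots
# (Lee–Wei–de Wolf 2017, §3: Lemma 2, Lemma 10, Theorem 11, Lemma 12, Lemma 13, Theorem 14,
# Example 15, Theorem 16; §6.1: Theorem 43 (real form), Proposition 44) — all PROVED

Source: T. Lee, Z. Wei, R. de Wolf, *Some upper and lower bounds on PSD-rank*, Math. Program. 162
(2017) 495–521 = arXiv:1407.4308 [LeeWeiDeWolf2017]; held text `paper:arxiv-1407.4308`, p07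
(`pNN` = held-text chunk). In this source "PSD-rank" allows complex Hermitian psd factors (p05:
"we allow the matrices of the PSD-factorization to be arbitrary Hermitian PSD matrices"), i.e. it is
the tree's `HasComplexPsdFactorization` (`HexagonComplexPsdRank.lean`); the real statements follow
(`HasPsdFactorization.toComplex`).

Printed statements (p05/p07, verbatim). "**Lemma 2.** ([Zha12]) If `A` is a nonnegative matrix, then
`rank_psd(A) ≤ min_{M : M ∘ M̄ = A} rank(M)`." "**Theorem 11.** Let `A` be an `m`-by-`n` nonnegative
matrix, and `A'` be the entry-wise square root of `A` [...]. If every column of `A'` has no dominant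
entry, then the PSD-rank of `A` is less than `m`." (proof: phases making every column of
`M = A' ∘ e^{iθ}` sum to zero, so the rows of `M` are dependent, then Lemma 2). "**Example 15.** Let
`A = [1 a; a 1]` [...] for `a ∈ [−1+√2, 1+√2] \ {1}` we have `rank_psd(A ⊗ A) < rank_psd(A)²`."
"**Theorem 16.** If `A` is a nonnegative matrix, then `rank_psd(A) ≤ rank_psd^ℝ(A) ≤ 2 rank_psd(A)`."
 "**Lemma 12.** If `P₁` and `P₂` are two nonnegative matrices,
then it holds that `rank_psd(P₁ ⊗ P₂) ≤ rank_psd(P₁) rank_psd(P₂)`." (factors `C_i ⊗ E_k`,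
`D_j ⊗ F_l`). "The disjointness function, `DISJ_n(x,y)`, is defined to be `1` if `x ∩ y = ∅` and `0`
otherwise. We denote its corresponding `2ⁿ`-by-`2ⁿ` matrix by `D_n` [...] **Lemma 13.** Suppose `A`
is an `m`-by-`n` nonnegative matrix, and has the following block expression, `A = [B C; D 0]`.
Then `rank_psd(A) ≥ rank_psd(C) + rank_psd(D)`." (proof: the supports of `Σ_{i>k} E_i` and
`Σ_{j>l} F_j` are orthogonal, and their dimensions are at least `rank_psd(D)`, `rank_psd(C)`; "also
found independently by Gábor Braun and Sebastian Pokutta"). "**Theorem 14.** `rank_psd(D_n) = 2ⁿ`."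
(proof: `D_{k+1} = [D_k D_k; D_k 0]`, Lemma 13, `rank_psd(D_1) = 2`; `≤` by Lemma 12 and
`D_k = D_1^{⊗k}`).

## Contents

* `HasComplexPsdFactorization.kronecker` (= `LeeWeiDeWolf2017_lemma12`) — **Lemma 12**.
* `HasComplexPsdFactorization.exists_add_le_of_zero_block` (= `LeeWeiDeWolf2017_lemma13`) — **Lemma
  13**, for an arbitrary zero block `M(ρ₂ a, γ₂ b) = 0` (row maps `ρ₁, ρ₂`, column maps `γ₁, γ₂`,
  no disjointness or bijectivity needed): a size-`r` factorization yields factorizations of the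
  blocks `C = M(ρ₁ ·, γ₂ ·)` and `D = M(ρ₂ ·, γ₁ ·)` of sizes `r₁ + r₂ ≤ r`. Proof as printed, in the
  form of the tree's `PrakashEtAl2017_lemma4_holds` (`CompletelyPsdRank.lean`): `Tr(E_iF_j) = 0`
  gives `E_iF_j = 0`; with `G = ⋂_{j right} ker F_j` the bottom `E_i` have range in `G`, the right
  `F_j` in `Gᗮ`; compress by orthonormal bases (`Z ↦ UᴴZU`), sizes `dim G + dim Gᗮ = r`.
* `disjointnessMatrix n : (Fin n → Bool) → (Fin n → Bool) → ℝ` (`x, y ⊆ [n]` as bit strings),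
  `disjointnessMatrix_cons_cons` (the block recursion `D_{k+1} = [D_k D_k; D_k 0]` on the first
  bit), `two_pow_le_of_hasComplexPsdFactorization_disjointnessMatrix` (`≥ 2ⁿ`, induction with Lemma
  13), `hasComplexPsdFactorization_disjointnessMatrix` (`≤ 2ⁿ`; here simply because `D_n` has `2ⁿ`
  nonnegative rows, `HasPsdFactorization.of_entry_nonneg_card_rows`, instead of the printed tensor
  route), **`LeeWeiDeWolf2017_thm14`** (`rank_psd^ℂ(D_n) = 2ⁿ` exactly) and the real form
  `disjointnessMatrix_psdRank` (`rank_psd^ℝ(D_n) = 2ⁿ`).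
* (appended) `HasComplexPsdFactorization.mono` (padding by an isometry); **Lemma 2**
  (`HasComplexPsdFactorization.of_normSq_rank`, `LeeWeiDeWolf2017_lemma2`: `A = M ∘ M̄ ⇒
  rank_psd^ℂ A ≤ rank M`, by a rank factorization of `M` and `of_normSq`); the **mechanism of
  Theorem 11** (`HasComplexPsdFactorization.of_normSq_of_colSum_eq_zero`: a Hadamard square root
  with vanishing column sums gives `rank_psd^ℂ ≤ m − 1`; Lemma 10's phase construction is NOT
  transcribed); **Theorem 16** (`LeeWeiDeWolf2017_thm16`, both halves from
  `HexagonComplexPsdRank.lean`); **Example 15** (`lwdwPair`, `lwdwPairTensor`, the explicit root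
  `lwdwRoot` with phase `lwdwPhase`, `cos θ = (a−1)/(2√a)`: `hasComplexPsdFactorization_lwdwPairTensor_three`
  for all `a > 0` with `(a−1)² ≤ 4a`, `two_le_of_hasComplexPsdFactorization_lwdwPair` for `a ≠ ±1`,
  and `LeeWeiDeWolf2017_ex15` on the printed range `a ∈ [√2−1, √2+1] \ {1}`:
  `rank_psd^ℂ(A ⊗ A) ≤ 3 < 4 ≤ rank_psd^ℂ(A)²`).
* (appended) **Lemma 10** (`LeeWeiDeWolf2017_lemma10`: a nonnegative vector without dominant entry
  admits unit phases with `Σ v_j e^{iθ_j} = 0`; proved in the quantitative form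
  `exists_units_normSq_sum_eq` — every length `ρ` allowed by the polygon inequalities is attained —
  by induction on `m`, closing one side at a time with the law of cosines
  `exists_unit_normSq_add_eq`, instead of the printed grouping into a triangle) and **Theorem 11 in
  full** (`LeeWeiDeWolf2017_thm11`: no dominant entry in any column of `√A` ⇒ `rank_psd^ℂ(A) ≤ m − 1`).
* (appended) **§6.1, approximations of the identity** (p13): `LeeWeiDeWolf2017_thm43_real` — Theorem 43
  (`rank_psd ≥ n/(1 + ε(n−1))` for an `ε`-approximation of the identity) for the tree's REAL
  factorizations, through the real `B₄` bound `LeeWeiDeWolf2017_thm24_real`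
  (`PsdRankFidelityLowerBounds.lean`); `offDiagConst n ε` (ones on the diagonal, `ε` off it) and
  **Proposition 44**: `LeeWeiDeWolf2017_prop44_notFull` (`ε ≥ 1/(n−1)²`, `n ≥ 3` ⇒ complex psd rank
  `≤ n − 1`, by Theorem 11; scope note: for `n = 2` the printed claim needs `ε ≤ 1`) and
  `LeeWeiDeWolf2017_prop44_full_real` (`ε < 1/(n−1)²` ⇒ every real psd factorization has size `≥ n`);
  **Proposition 45** (`LeeWeiDeWolf2017_prop45`: `I_k ⊗ B`, `B = A_{1/(m−1)²}` of size `m ≥ 3`, has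
  complex psd rank `≤ k(m−1) = n − n/m`, by Lemma 12).
-/

noncomputable section

open Matrix Finset

open scoped MatrixOrder ComplexOrder Kronecker

namespace Literature.Combinatorics.Optimization

/-! ### Plumbing: `Tr(PQ) = 0 ⇒ PQ = 0`, compression by an orthonormal basis -/

/-- `Tr(P Q) = 0` forces `P Q = 0` for Hermitian psd complex `P, Q`. [folklore] -/
private theorem mul_eq_zero_of_trace_eq_zero_herm {r : ℕ} {P Q : Matrix (Fin r) (Fin r) ℂ}
    (hP : P.PosSemidef) (hQ : Q.PosSemidef) (h : (P * Q).trace = 0) : P * Q = 0 := by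
  classical
  obtain ⟨C, hC⟩ := CStarAlgebra.nonneg_iff_eq_star_mul_self.mp hQ.nonneg
  have hQC : Q = Cᴴ * C := by rw [hC, star_eq_conjTranspose]
  have hsum : (P * Q).trace = ∑ l, star (star (C l)) ⬝ᵥ (P *ᵥ star (C l)) := by
    rw [hQC, ← Matrix.mul_assoc, Matrix.trace_mul_comm]
    simp only [Matrix.trace, Matrix.diag_apply, Matrix.mul_apply, Matrix.conjTranspose_apply,
      dotProduct, Matrix.mulVec, Finset.mul_sum, star_star, Pi.star_apply]
  have hnn : ∀ l, 0 ≤ star (star (C l)) ⬝ᵥ (P *ᵥ star (C l)) := fun l =>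
    hP.dotProduct_mulVec_nonneg (star (C l))
  have hzero : ∀ l, star (star (C l)) ⬝ᵥ (P *ᵥ star (C l)) = 0 := by
    have h0 : ∑ l, star (star (C l)) ⬝ᵥ (P *ᵥ star (C l)) = 0 := by rw [← hsum, h]
    exact fun l => (Finset.sum_eq_zero_iff_of_nonneg fun l _ => hnn l).1 h0 l (Finset.mem_univ l)
  have hker : ∀ l, P *ᵥ star (C l) = 0 := fun l => (hP.dotProduct_mulVec_zero_iff _).1 (hzero l)
  have hPCh : P * Cᴴ = 0 := by
    ext s l
    have := congrFun (hker l) s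
    simpa only [Matrix.mul_apply, Matrix.conjTranspose_apply, Matrix.mulVec, dotProduct,
      Matrix.zero_apply, Pi.zero_apply, Pi.star_apply] using this
  rw [hQC, ← Matrix.mul_assoc, hPCh, Matrix.zero_mul]

section Compression

variable {d m : ℕ} {K : Submodule ℂ (EuclideanSpace ℂ (Fin d))}

/-- The `d × m` matrix of an orthonormal basis of a subspace `K ⊆ ℂ^d`. [folklore] -/
private def onbMatC (b : OrthonormalBasis (Fin m) ℂ K) : Matrix (Fin d) (Fin m) ℂ :=
  Matrix.of fun s a => (b a : EuclideanSpace ℂ (Fin d)) s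

/-- `Q Qᴴ v = v` for `v ∈ K`. [folklore] -/
private theorem onbMatC_proj_mulVec (b : OrthonormalBasis (Fin m) ℂ K)
    {v : EuclideanSpace ℂ (Fin d)} (hv : v ∈ K) :
    (onbMatC b * (onbMatC b)ᴴ) *ᵥ v.ofLp = v.ofLp := by
  classical
  funext s
  have h := b.sum_repr' ⟨v, hv⟩
  have h2 := congrArg (fun w : K => (w : EuclideanSpace ℂ (Fin d)) s) h
  simp only [Submodule.coe_sum, Submodule.coe_smul, Submodule.coe_inner] at h2
  have h3 : ∑ a, (inner ℂ (b a : EuclideanSpace ℂ (Fin d)) v) *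
      (b a : EuclideanSpace ℂ (Fin d)) s = v s := by
    simpa [WithLp.ofLp_sum, Finset.sum_apply, smul_eq_mul] using h2
  rw [← mulVec_mulVec]
  change _ = v s
  rw [← h3]
  simp only [mulVec, dotProduct, onbMatC, conjTranspose_apply, of_apply]
  refine sum_congr rfl fun a _ => ?_
  rw [mul_comm]
  congr 1
  simp [PiLp.inner_apply, mul_comm]

/-- `Q Qᴴ A = A` when the columns of `A` lie in `K`. [folklore] -/
private theorem onbMatC_proj_mul (b : OrthonormalBasis (Fin m) ℂ K) {A : Matrix (Fin d) (Fin d) ℂ}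
    (hrange : ∀ w : Fin d → ℂ, WithLp.toLp 2 (A *ᵥ w) ∈ K) :
    onbMatC b * (onbMatC b)ᴴ * A = A := by
  classical
  ext s t
  have h := congrFun (onbMatC_proj_mulVec b (hrange (Pi.single t 1))) s
  simp only [mulVec_mulVec] at h
  simpa [Matrix.mulVec_single_one] using h

/-- Compression to `K`: `Tr(QᴴAQ · QᴴBQ) = Tr(A B)` for Hermitian `A` with columns in `K`. [folklore] -/
private theorem trace_compressC' (b : OrthonormalBasis (Fin m) ℂ K) {A B : Matrix (Fin d) (Fin d) ℂ}
    (hA : Aᴴ = A) (hrange : ∀ w : Fin d → ℂ, WithLp.toLp 2 (A *ᵥ w) ∈ K) :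
    ((onbMatC b)ᴴ * A * onbMatC b * ((onbMatC b)ᴴ * B * onbMatC b)).trace = (A * B).trace := by
  set Q := onbMatC b with hQ
  have hPA : Q * Qᴴ * A = A := onbMatC_proj_mul b hrange
  have hAP : A * (Q * Qᴴ) = A := by
    have h := congrArg conjTranspose hPA
    rw [conjTranspose_mul, conjTranspose_mul, conjTranspose_conjTranspose, hA] at h
    exact h
  calc (Qᴴ * A * Q * (Qᴴ * B * Q)).trace = ((Qᴴ * A * Q * Qᴴ * B) * Q).trace := by
        simp only [Matrix.mul_assoc]
    _ = (Q * (Qᴴ * A * Q * Qᴴ * B)).trace := Matrix.trace_mul_comm _ _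
    _ = ((Q * Qᴴ * A) * (Q * Qᴴ) * B).trace := by simp only [Matrix.mul_assoc]
    _ = (A * B).trace := by rw [hPA, hAP]

end Compression

/-! ### Lemma 12: tensoring -/

/-- Kronecker products of complex psd matrices are psd (`XᴴX ⊗ YᴴY = (X ⊗ Y)ᴴ(X ⊗ Y)`). [folklore] -/
private theorem posSemidef_kronecker_complex {r s : ℕ} {A : Matrix (Fin r) (Fin r) ℂ}
    {B : Matrix (Fin s) (Fin s) ℂ} (hA : A.PosSemidef) (hB : B.PosSemidef) : (A ⊗ₖ B).PosSemidef := by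
  obtain ⟨X, rfl⟩ := CStarAlgebra.nonneg_iff_eq_star_mul_self.mp hA.nonneg
  obtain ⟨Y, rfl⟩ := CStarAlgebra.nonneg_iff_eq_star_mul_self.mp hB.nonneg
  rw [mul_kronecker_mul, star_eq_conjTranspose, star_eq_conjTranspose, ← conjTranspose_kronecker]
  exact posSemidef_conjTranspose_mul_self _

/-- **LWdW Lemma 12** (p07, verbatim: "If `P₁` and `P₂` are two nonnegative matrices, then it holds that
`rank_psd(P₁ ⊗ P₂) ≤ rank_psd(P₁) rank_psd(P₂)`"): factors `C_i ⊗ E_k`, `D_j ⊗ F_l`.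
[cite: LeeWeiDeWolf2017, Lemma 12 (p07)] -/
theorem HasComplexPsdFactorization.kronecker {ι κ ι' κ' : Type*} {M : ι → κ → ℝ} {N : ι' → κ' → ℝ}
    {r s : ℕ} (hM : HasComplexPsdFactorization M r) (hN : HasComplexPsdFactorization N s) :
    HasComplexPsdFactorization (fun (p : ι × ι') (q : κ × κ') => M p.1 q.1 * N p.2 q.2) (r * s) := by
  obtain ⟨A, B, hA, hB, hMf⟩ := hM
  obtain ⟨C, D, hC, hD, hNf⟩ := hN
  let e : Fin (r * s) ≃ Fin r × Fin s := finProdFinEquiv.symm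
  have htr : ∀ Z : Matrix (Fin r × Fin s) (Fin r × Fin s) ℂ, (Z.submatrix e e).trace = Z.trace :=
    fun Z => by
    simp only [Matrix.trace, Matrix.diag_apply, Matrix.submatrix_apply]
    exact Fintype.sum_equiv e _ _ fun x => rfl
  refine ⟨fun p => (A p.1 ⊗ₖ C p.2).submatrix e e, fun q => (B q.1 ⊗ₖ D q.2).submatrix e e,
    fun p => (posSemidef_kronecker_complex (hA _) (hC _)).submatrix e,
    fun q => (posSemidef_kronecker_complex (hB _) (hD _)).submatrix e, fun p q => ?_⟩
  rw [submatrix_mul_equiv, htr, ← mul_kronecker_mul, trace_kronecker, ← hMf, ← hNf, Complex.ofReal_mul]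

/-- **LWdW Lemma 12**, named form. [cite: LeeWeiDeWolf2017, Lemma 12 (p07)] -/
theorem LeeWeiDeWolf2017_lemma12 {ι κ ι' κ' : Type*} {M : ι → κ → ℝ} {N : ι' → κ' → ℝ} {r s : ℕ}
    (hM : HasComplexPsdFactorization M r) (hN : HasComplexPsdFactorization N s) :
    HasComplexPsdFactorization (fun (p : ι × ι') (q : κ × κ') => M p.1 q.1 * N p.2 q.2) (r * s) :=
  hM.kronecker hN

/-! ### Lemma 13: a zero block splits the psd rank -/

/-- **LWdW Lemma 13** (Braun–Pokutta; p07, verbatim: "Suppose `A` is an `m`-by-`n` nonnegative matrix,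
and has the following block expression, `A = [B C; D 0]`. Then
`rank_psd(A) ≥ rank_psd(C) + rank_psd(D)`"). Typed for an arbitrary zero block: if
`M(ρ₂ a, γ₂ b) = 0` for all `a, b`, a complex psd factorization of `M` of size `r` yields
factorizations of `C = M(ρ₁ ·, γ₂ ·)` and `D = M(ρ₂ ·, γ₁ ·)` of sizes `r₁ + r₂ ≤ r`. Proof as printed:
`Tr(E_iF_j) = 0` forces `E_iF_j = 0`, so with `G = ⋂_b ker F_{γ₂ b}` the `E_{ρ₂ a}` have range in `G`
("the support of `Σ E_i` is orthogonal to that of `Σ F_j`") and the `F_{γ₂ b}` in `Gᗮ`; compressing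
by orthonormal bases of `G`, `Gᗮ` gives the two factorizations. [cite: LeeWeiDeWolf2017, Lemma 13 (p07)] -/
theorem HasComplexPsdFactorization.exists_add_le_of_zero_block {ι κ ι₁ ι₂ κ₁ κ₂ : Type*}
    {M : ι → κ → ℝ} {r : ℕ} (h : HasComplexPsdFactorization M r) (ρ₁ : ι₁ → ι) (ρ₂ : ι₂ → ι)
    (γ₁ : κ₁ → κ) (γ₂ : κ₂ → κ) (h0 : ∀ a b, M (ρ₂ a) (γ₂ b) = 0) :
    ∃ r₁ r₂ : ℕ, r₁ + r₂ ≤ r ∧ HasComplexPsdFactorization (fun a b => M (ρ₁ a) (γ₂ b)) r₁ ∧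
      HasComplexPsdFactorization (fun a b => M (ρ₂ a) (γ₁ b)) r₂ := by
  classical
  obtain ⟨E, F, hE, hF, hM⟩ := h
  have hHE : ∀ i, (E i)ᴴ = E i := fun i => (hE i).1.eq
  have hHF : ∀ j, (F j)ᴴ = F j := fun j => (hF j).1.eq
  have hEF : ∀ a b, E (ρ₂ a) * F (γ₂ b) = 0 := fun a b =>
    mul_eq_zero_of_trace_eq_zero_herm (hE _) (hF _) (by rw [← hM, h0 a b, Complex.ofReal_zero])
  have hFE : ∀ a b, F (γ₂ b) * E (ρ₂ a) = 0 := fun a b => by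
    rw [← hHF (γ₂ b), ← hHE (ρ₂ a), ← conjTranspose_mul, hEF, conjTranspose_zero]
  -- `G = ⋂_b ker F_{γ₂ b}`
  let G : Submodule ℂ (EuclideanSpace ℂ (Fin r)) :=
    { carrier := {v | ∀ b, F (γ₂ b) *ᵥ v.ofLp = 0}
      add_mem' := fun {u v} hu hv b => by
        simp only [Set.mem_setOf_eq] at hu hv ⊢
        rw [WithLp.ofLp_add, mulVec_add, hu b, hv b, add_zero]
      zero_mem' := fun b => by simp
      smul_mem' := fun c v hv b => by
        simp only [Set.mem_setOf_eq] at hv ⊢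
        rw [WithLp.ofLp_smul, mulVec_smul, hv b, smul_zero] }
  have hEG : ∀ a (w : Fin r → ℂ), WithLp.toLp 2 (E (ρ₂ a) *ᵥ w) ∈ G := fun a w b => by
    change F (γ₂ b) *ᵥ (WithLp.toLp 2 (E (ρ₂ a) *ᵥ w)).ofLp = 0
    rw [WithLp.ofLp_toLp, mulVec_mulVec, hFE, zero_mulVec]
  have hFG : ∀ b (w : Fin r → ℂ), WithLp.toLp 2 (F (γ₂ b) *ᵥ w) ∈ Gᗮ := fun b w => by
    rw [Submodule.mem_orthogonal]
    intro u hu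
    have hu' : F (γ₂ b) *ᵥ u.ofLp = 0 := hu b
    have hinner : inner ℂ u (WithLp.toLp 2 (F (γ₂ b) *ᵥ w)) =
        star u.ofLp ⬝ᵥ (F (γ₂ b) *ᵥ w) := by
      simp [PiLp.inner_apply, dotProduct, mul_comm]
    rw [hinner, dotProduct_mulVec, ← hHF (γ₂ b), ← star_mulVec, hu', star_zero, zero_dotProduct]
  let bG := stdOrthonormalBasis ℂ G
  let bF := stdOrthonormalBasis ℂ Gᗮ
  have hdim : Module.finrank ℂ G + Module.finrank ℂ Gᗮ = r := by
    rw [Submodule.finrank_add_finrank_orthogonal, finrank_euclideanSpace, Fintype.card_fin]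
  refine ⟨Module.finrank ℂ Gᗮ, Module.finrank ℂ G, by omega, ?_, ?_⟩
  · -- the block `C`: compress to `Gᗮ`
    refine ⟨fun a => (onbMatC bF)ᴴ * E (ρ₁ a) * onbMatC bF, fun b => (onbMatC bF)ᴴ * F (γ₂ b) * onbMatC bF,
      fun a => (hE _).conjTranspose_mul_mul_same (onbMatC bF),
      fun b => (hF _).conjTranspose_mul_mul_same (onbMatC bF), fun a b => ?_⟩
    rw [hM, Matrix.trace_mul_comm (E (ρ₁ a)), Matrix.trace_mul_comm ((onbMatC bF)ᴴ * E (ρ₁ a) * onbMatC bF),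
      trace_compressC' bF (hHF _) (hFG b)]
  · -- the block `D`: compress to `G`
    refine ⟨fun a => (onbMatC bG)ᴴ * E (ρ₂ a) * onbMatC bG, fun b => (onbMatC bG)ᴴ * F (γ₁ b) * onbMatC bG,
      fun a => (hE _).conjTranspose_mul_mul_same (onbMatC bG),
      fun b => (hF _).conjTranspose_mul_mul_same (onbMatC bG), fun a b => ?_⟩
    rw [hM, trace_compressC' bG (hHE _) (hEG a)]

/-- **LWdW Lemma 13**, named form. [cite: LeeWeiDeWolf2017, Lemma 13 (p07)] -/
theorem LeeWeiDeWolf2017_lemma13 {ι κ ι₁ ι₂ κ₁ κ₂ : Type*} {M : ι → κ → ℝ} {r : ℕ}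
    (h : HasComplexPsdFactorization M r) (ρ₁ : ι₁ → ι) (ρ₂ : ι₂ → ι) (γ₁ : κ₁ → κ) (γ₂ : κ₂ → κ)
    (h0 : ∀ a b, M (ρ₂ a) (γ₂ b) = 0) :
    ∃ r₁ r₂ : ℕ, r₁ + r₂ ≤ r ∧ HasComplexPsdFactorization (fun a b => M (ρ₁ a) (γ₂ b)) r₁ ∧
      HasComplexPsdFactorization (fun a b => M (ρ₂ a) (γ₁ b)) r₂ :=
  h.exists_add_le_of_zero_block ρ₁ ρ₂ γ₁ γ₂ h0

/-! ### The disjointness matrix and Theorem 14 -/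

/-- **The disjointness matrix** `D_n` (p07, verbatim: "Let `x, y` be two subsets of `{1,2,…,n}`. The
disjointness function, `DISJ_n(x,y)`, is defined to be `1` if `x ∩ y = ∅` and `0` otherwise. We denote
its corresponding `2ⁿ`-by-`2ⁿ` matrix by `D_n`"), with subsets of `[n]` as bit strings
`x, y : Fin n → Bool`. [cite: LeeWeiDeWolf2017, §3.2 (p07, DISJ_n)] -/
def disjointnessMatrix (n : ℕ) (x y : Fin n → Bool) : ℝ :=
  if ∀ i, ¬ (x i = true ∧ y i = true) then 1 else 0

/-- `D_n` is a `0/1`, hence nonnegative, matrix. [cite: LeeWeiDeWolf2017, §3.2 (p07)] -/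
theorem disjointnessMatrix_nonneg (n : ℕ) (x y : Fin n → Bool) : 0 ≤ disjointnessMatrix n x y := by
  unfold disjointnessMatrix
  split_ifs <;> norm_num

/-- **The block recursion `D_{k+1} = [D_k D_k; D_k 0]`** (p07, proof of Theorem 14), on the first
element of `[k+1]`: `DISJ(ax, by) = [¬(a ∧ b)] · DISJ(x, y)`. [cite: LeeWeiDeWolf2017, Thm. 14 proof (p07)] -/
theorem disjointnessMatrix_cons_cons (k : ℕ) (a b : Bool) (x y : Fin k → Bool) :
    disjointnessMatrix (k + 1) (Fin.cons a x : Fin (k + 1) → Bool) (Fin.cons b y : Fin (k + 1) → Bool) =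
      (if a = true ∧ b = true then 0 else 1) * disjointnessMatrix k x y := by
  simp only [disjointnessMatrix, Fin.forall_fin_succ, Fin.cons_zero, Fin.cons_succ]
  by_cases hab : a = true ∧ b = true <;>
    by_cases hxy : ∀ i, ¬ (x i = true ∧ y i = true) <;> simp [hab, hxy]

/-- `D_0 = (1)`. [cite: LeeWeiDeWolf2017, §3.2 (p07)] -/
theorem disjointnessMatrix_zero (x y : Fin 0 → Bool) : disjointnessMatrix 0 x y = 1 := by
  simp [disjointnessMatrix]

/-- **Theorem 14, lower bound**: every complex psd factorization of `D_n` has size `≥ 2ⁿ`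
(induction on `n` with Lemma 13 on `D_{k+1} = [D_k D_k; D_k 0]`; `D_0 = (1)` needs size `≥ 1`).
[cite: LeeWeiDeWolf2017, Thm. 14 (p07)] -/
theorem two_pow_le_of_hasComplexPsdFactorization_disjointnessMatrix :
    ∀ (n r : ℕ), HasComplexPsdFactorization (disjointnessMatrix n) r → 2 ^ n ≤ r := by
  intro n
  induction n with
  | zero =>
    rintro r ⟨A, B, -, -, hM⟩
    by_contra hr
    have hr0 : r = 0 := by omega
    subst hr0
    have h := hM Fin.elim0 Fin.elim0
    rw [disjointnessMatrix_zero] at h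
    simp [Matrix.trace] at h
  | succ k ih =>
    intro r h
    have hzero : ∀ x y : Fin k → Bool, disjointnessMatrix (k + 1) (Fin.cons true x : Fin (k + 1) → Bool)
        (Fin.cons true y : Fin (k + 1) → Bool) = 0 := fun x y => by
      rw [disjointnessMatrix_cons_cons]; simp
    obtain ⟨r₁, r₂, hr, h₁, h₂⟩ := h.exists_add_le_of_zero_block
      (fun x : Fin k → Bool => (Fin.cons false x : Fin (k + 1) → Bool))
      (fun x : Fin k → Bool => (Fin.cons true x : Fin (k + 1) → Bool))
      (fun y : Fin k → Bool => (Fin.cons false y : Fin (k + 1) → Bool))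
      (fun y : Fin k → Bool => (Fin.cons true y : Fin (k + 1) → Bool)) hzero
    have e₁ : (fun x y : Fin k → Bool => disjointnessMatrix (k + 1) (Fin.cons false x : Fin (k + 1) → Bool)
        (Fin.cons true y : Fin (k + 1) → Bool)) = disjointnessMatrix k := by
      funext x y; rw [disjointnessMatrix_cons_cons]; simp
    have e₂ : (fun x y : Fin k → Bool => disjointnessMatrix (k + 1) (Fin.cons true x : Fin (k + 1) → Bool)
        (Fin.cons false y : Fin (k + 1) → Bool)) = disjointnessMatrix k := by
      funext x y; rw [disjointnessMatrix_cons_cons]; simp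
    rw [e₁] at h₁
    rw [e₂] at h₂
    have i₁ := ih r₁ h₁
    have i₂ := ih r₂ h₂
    calc 2 ^ (k + 1) = 2 ^ k + 2 ^ k := by ring
      _ ≤ r₁ + r₂ := add_le_add i₁ i₂
      _ ≤ r := hr

/-- **Theorem 14, upper bound**: `D_n` has a complex (indeed real) psd factorization of size `2ⁿ` —
here because it is a nonnegative matrix with `2ⁿ` rows (the source: Lemma 12 and `D_k = D_1^{⊗k}`).
[cite: LeeWeiDeWolf2017, Thm. 14 (p07)] -/
theorem hasPsdFactorization_disjointnessMatrix (n : ℕ) :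
    HasPsdFactorization (disjointnessMatrix n) (2 ^ n) := by
  classical
  have h := HasPsdFactorization.of_entry_nonneg_card_rows (M := disjointnessMatrix n)
    (disjointnessMatrix_nonneg n)
  rwa [Fintype.card_fun, Fintype.card_bool, Fintype.card_fin] at h

/-- **Theorem 14, upper bound, complex form.** [cite: LeeWeiDeWolf2017, Thm. 14 (p07)] -/
theorem hasComplexPsdFactorization_disjointnessMatrix (n : ℕ) :
    HasComplexPsdFactorization (disjointnessMatrix n) (2 ^ n) :=
  (hasPsdFactorization_disjointnessMatrix n).toComplex

/-- **LWdW Theorem 14** (p07, verbatim: "`rank_psd(D_n) = 2ⁿ`"), `rank_psd` = complex psd rank: `D_n`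
has a complex psd factorization of size `2ⁿ` and none of smaller size.
[cite: LeeWeiDeWolf2017, Thm. 14 (p07)] -/
theorem LeeWeiDeWolf2017_thm14 (n : ℕ) :
    HasComplexPsdFactorization (disjointnessMatrix n) (2 ^ n) ∧
      ∀ r, HasComplexPsdFactorization (disjointnessMatrix n) r → 2 ^ n ≤ r :=
  ⟨hasComplexPsdFactorization_disjointnessMatrix n,
    two_pow_le_of_hasComplexPsdFactorization_disjointnessMatrix n⟩

/-- **Theorem 14 for the real psd rank**: `rank_psd^ℝ(D_n) = 2ⁿ` as well (a real factorization is a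
complex one). [cite: LeeWeiDeWolf2017, Thm. 14 (p07) and §2.1 (p05, real PSD-rank)] -/
theorem disjointnessMatrix_psdRank (n : ℕ) :
    HasPsdFactorization (disjointnessMatrix n) (2 ^ n) ∧
      ∀ r, HasPsdFactorization (disjointnessMatrix n) r → 2 ^ n ≤ r :=
  ⟨hasPsdFactorization_disjointnessMatrix n,
    fun r h => two_pow_le_of_hasComplexPsdFactorization_disjointnessMatrix n r h.toComplex⟩

/-! ### Plumbing: rank factorizations and left kernel vectors over a field (appended) -/

/-- A matrix of rank `|σ|` factors through `K^σ` (columns spanning the column space and the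
coordinates of all columns in them). [folklore] -/
private theorem exists_rank_factorization_field {K : Type*} [Field K] {m n σ : Type*} [Fintype m]
    [Fintype n] [Fintype σ] (M : Matrix m n K) (hσ : Fintype.card σ = M.rank) :
    ∃ (U : Matrix m σ K) (V : Matrix σ n K), M = U * V := by
  classical
  obtain ⟨t, ht_sub, ht_span, ht_li⟩ := exists_linearIndependent K (Set.range M.col)
  have ht_fin : t.Finite := (Set.finite_range _).subset ht_sub
  letI : Fintype t := ht_fin.fintype
  have hcard : Fintype.card t = Fintype.card σ := by
    rw [← Set.toFinset_card, ← finrank_span_set_eq_card ht_li, ht_span,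
      ← Matrix.rank_eq_finrank_span_cols, hσ]
  let e : σ ≃ t := Fintype.equivOfCardEq hcard.symm
  have hJ : ∀ l : σ, ∃ j : n, M.col j = (e l : m → K) := fun l => ht_sub (e l).2
  choose J hJ using hJ
  have hrange : Set.range (fun l : σ => (e l : m → K)) = t := by
    ext v
    constructor
    · rintro ⟨l, rfl⟩; exact (e l).2
    · intro hv; exact ⟨e.symm ⟨v, hv⟩, by simp⟩
  have hC : ∀ j : n, ∃ cj : σ → K, ∑ l, cj l • (e l : m → K) = M.col j := fun j => by
    rw [← Submodule.mem_span_range_iff_exists_fun K, hrange, ht_span]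
    exact Submodule.subset_span ⟨j, rfl⟩
  choose C hC using hC
  refine ⟨fun i l => M i (J l), fun l j => C j l, ?_⟩
  ext i j
  have h := congrFun (hC j) i
  simp only [Finset.sum_apply, Pi.smul_apply, smul_eq_mul] at h
  rw [Matrix.mul_apply, show M i j = M.col j i from rfl, ← h]
  refine sum_congr rfl fun l _ => ?_
  rw [← hJ l, mul_comm]
  rfl

/-- A nonzero left kernel vector forces `rank < #rows` (any field). [folklore] -/
private theorem rank_add_one_le_card_of_vecMul_eq_zero' {K : Type*} [Field K] {p q : Type*}
    [Fintype p] [Fintype q] (N : Matrix p q K) {v : p → K} (hv : v ≠ 0) (hvN : v ᵥ* N = 0) :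
    N.rank + 1 ≤ Fintype.card p := by
  classical
  have hker : v ∈ LinearMap.ker Nᵀ.mulVecLin := by
    rw [LinearMap.mem_ker, Matrix.mulVecLin_apply, Matrix.mulVec_transpose, hvN]
  have h1 : 1 ≤ Module.finrank K (LinearMap.ker Nᵀ.mulVecLin) := by
    refine Module.finrank_pos_iff_exists_ne_zero.mpr ⟨⟨v, hker⟩, fun h => hv ?_⟩
    simpa using congrArg Subtype.val h
  have h2 : Nᵀ.rank + Module.finrank K (LinearMap.ker Nᵀ.mulVecLin) = Fintype.card p := by
    have := LinearMap.finrank_range_add_finrank_ker Nᵀ.mulVecLin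
    rw [Module.finrank_fintype_fun_eq_card] at this
    exact this
  rw [Matrix.rank_transpose] at h2
  omega

/-! ### Monotonicity in the size -/

/-- A complex psd factorization of size `r` pads to one of any size `s ≥ r` (conjugate every factor
by the isometry `S : ℂ^r → ℂ^s` of the first `r` coordinates: `SAS^*` is psd and
`Tr(SAS^* SBS^*) = Tr(AB)` as `S^*S = I`), so "`rank_psd ≤ r`" is monotone in `r`.
[cite: LeeWeiDeWolf2017, Def. 1 (p05, "the minimum r")] -/
theorem HasComplexPsdFactorization.mono {ι κ : Type*} {M : ι → κ → ℝ} {r s : ℕ}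
    (h : HasComplexPsdFactorization M r) (hrs : r ≤ s) : HasComplexPsdFactorization M s := by
  classical
  obtain ⟨A, B, hA, hB, hM⟩ := h
  let S : Matrix (Fin s) (Fin r) ℂ := Matrix.of fun a b => if a = Fin.castLE hrs b then 1 else 0
  have hS : Sᴴ * S = 1 := by
    ext b b'
    rw [Matrix.mul_apply, Finset.sum_eq_single (Fin.castLE hrs b)]
    · simp only [conjTranspose_apply, S, of_apply, Matrix.one_apply]
      by_cases hbb : b = b'
      · subst hbb; simp
      · simp [hbb, (Fin.castLE_injective hrs).ne hbb]
    · intro a _ ha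
      simp only [conjTranspose_apply, S, of_apply, if_neg ha, star_zero, zero_mul]
    · intro h; exact absurd (Finset.mem_univ _) h
  refine ⟨fun i => S * A i * Sᴴ, fun j => S * B j * Sᴴ, fun i => (hA i).mul_mul_conjTranspose_same S,
    fun j => (hB j).mul_mul_conjTranspose_same S, fun i j => ?_⟩
  rw [hM i j]
  calc (A i * B j).trace = (A i * (Sᴴ * S) * B j * (Sᴴ * S)).trace := by
        rw [hS, Matrix.mul_one, Matrix.mul_one]
    _ = ((A i * Sᴴ * (S * B j * Sᴴ)) * S).trace := by simp only [Matrix.mul_assoc]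
    _ = (S * (A i * Sᴴ * (S * B j * Sᴴ))).trace := Matrix.trace_mul_comm _ _
    _ = (S * A i * Sᴴ * (S * B j * Sᴴ)).trace := by simp only [Matrix.mul_assoc]

/-! ### Lemma 2: Hadamard square roots bound the psd rank -/

/-- **LWdW Lemma 2** ([Zha12]; p05, verbatim: "If `A` is a nonnegative matrix, then
`rank_psd(A) ≤ min_{M : M ∘ M̄ = A} rank(M)`"): if `A_{ij} = |M_{ij}|²` then `A` has a complex psd
factorization of size `rank M` (a rank factorization `M = UV` gives `A_{ij} = |u_i · v_j|²`, rank-one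
factors `HasComplexPsdFactorization.of_normSq`). [cite: LeeWeiDeWolf2017, Lemma 2 (p05)] -/
theorem HasComplexPsdFactorization.of_normSq_rank {m n : Type*} [Fintype m] [Fintype n]
    {A : m → n → ℝ} (M : Matrix m n ℂ) (h : ∀ i j, A i j = Complex.normSq (M i j)) :
    HasComplexPsdFactorization A M.rank := by
  classical
  obtain ⟨U, V, hUV⟩ := exists_rank_factorization_field M (σ := Fin M.rank) (Fintype.card_fin _)
  refine HasComplexPsdFactorization.of_normSq (fun i => U i) (fun j l => V l j) fun i j => ?_
  have e : M i j = U i ⬝ᵥ fun l => V l j := by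
    have := congrFun (congrFun hUV i) j
    rw [Matrix.mul_apply] at this
    exact this
  rw [h i j, e]

/-- **LWdW Lemma 2**, with any `k ≥ rank M`. [cite: LeeWeiDeWolf2017, Lemma 2 (p05)] -/
theorem LeeWeiDeWolf2017_lemma2 {m n : Type*} [Fintype m] [Fintype n] {A : m → n → ℝ}
    (M : Matrix m n ℂ) (h : ∀ i j, A i j = Complex.normSq (M i j)) {k : ℕ} (hk : M.rank ≤ k) :
    HasComplexPsdFactorization A k :=
  (HasComplexPsdFactorization.of_normSq_rank M h).mono hk

/-! ### Theorem 11, the mechanism: a Hadamard square root with vanishing column sums -/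

/-- **The mechanism of LWdW Theorem 11** (p07, proof, verbatim: "Define `M(j,k) = A'(j,k)e^{iθ_{jk}}`.
Then `M ∘ M̄ = A` and `M` has rank `< m`: as each column of `M` sums to zero, the sum of the `m` rows
is the `0`-vector so they are linearly dependent. Lemma 2 then completes the proof"): if
`A_{ij} = |M_{ij}|²` and every column of `M` sums to zero then `rank_psd^ℂ(A) ≤ m − 1`. (Theorem 11
itself adds Lemma 10: such phases exist as soon as no column of `√A` has a dominant entry —
`LeeWeiDeWolf2017_lemma10`, `LeeWeiDeWolf2017_thm11` below.) [cite: LeeWeiDeWolf2017, Thm. 11 proof (p07)] -/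
theorem HasComplexPsdFactorization.of_normSq_of_colSum_eq_zero {m n : Type*} [Fintype m]
    [Fintype n] {A : m → n → ℝ} (M : Matrix m n ℂ) (h : ∀ i j, A i j = Complex.normSq (M i j))
    (hcol : ∀ j, ∑ i, M i j = 0) : HasComplexPsdFactorization A (Fintype.card m - 1) := by
  classical
  rcases isEmpty_or_nonempty m with hm | ⟨⟨i₀⟩⟩
  · exact ⟨fun i => isEmptyElim i, fun _ => 0, fun i => isEmptyElim i, fun _ => PosSemidef.zero,
      fun i => isEmptyElim i⟩
  have hv : (fun _ : m => (1 : ℂ)) ≠ 0 := fun h0 => one_ne_zero (congrFun h0 i₀)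
  have hvM : (fun _ : m => (1 : ℂ)) ᵥ* M = 0 := by
    funext j
    simp only [vecMul, dotProduct, one_mul, Pi.zero_apply]
    exact hcol j
  have hr := rank_add_one_le_card_of_vecMul_eq_zero' M hv hvM
  exact LeeWeiDeWolf2017_lemma2 M h (by omega)

/-! ### Theorem 16: real versus complex psd rank -/

/-- **LWdW Theorem 16** (p07, verbatim: "If `A` is a nonnegative matrix, then
`rank_psd(A) ≤ rank_psd^ℝ(A) ≤ 2 rank_psd(A)`"): a real psd factorization is a complex one of the
same size, and a complex one of size `r` realifies to a real one of size `2r` (both halves are in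
`HexagonComplexPsdRank.lean`: `HasPsdFactorization.toComplex`, `HasComplexPsdFactorization.toReal`).
[cite: LeeWeiDeWolf2017, Thm. 16 (p07)] -/
theorem LeeWeiDeWolf2017_thm16 {ι κ : Type*} {A : ι → κ → ℝ} {r : ℕ} :
    (HasPsdFactorization A r → HasComplexPsdFactorization A r) ∧
      (HasComplexPsdFactorization A r → HasPsdFactorization A (2 * r)) :=
  ⟨fun h => h.toComplex, fun h => by rw [two_mul]; exact h.toReal⟩

/-! ### Example 15: the psd rank is not multiplicative under tensoring -/

/-- The matrix `A = [1 a; a 1]` of Example 15. [cite: LeeWeiDeWolf2017, Ex. 15 (p07)] -/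
def lwdwPair (a : ℝ) : Matrix (Fin 2) (Fin 2) ℝ := Matrix.of fun x y => if x = y then 1 else a

/-- `A ⊗ A = [1 a a a²; a 1 a² a; a a² 1 a; a² a a 1]`, indexed by pairs as in Lemma 12.
[cite: LeeWeiDeWolf2017, Ex. 15 (p07)] -/
def lwdwPairTensor (a : ℝ) (p q : Fin 2 × Fin 2) : ℝ := lwdwPair a p.1 q.1 * lwdwPair a p.2 q.2

/-- The phase `w = e^{iθ}` with `cos θ = (a − 1)/(2√a)` used to kill the column sums.
[cite: LeeWeiDeWolf2017, Ex. 15 with Thm. 11 / Lemma 10 (p07)] -/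
def lwdwPhase (a : ℝ) : ℂ :=
  ⟨(a - 1) / (2 * Real.sqrt a), Real.sqrt (1 - ((a - 1) / (2 * Real.sqrt a)) ^ 2)⟩

/-- The Hadamard square root `M` of `A ⊗ A` with phases (`1` on the diagonal pattern, `√a·w̄`,
`√a·w` where one coordinate differs, `−a` where both differ): `M ∘ M̄ = A ⊗ A` and every column of
`M` sums to `1 − a + 2√a cos θ = 0`. [cite: LeeWeiDeWolf2017, Ex. 15 with Thm. 11 (p07)] -/
def lwdwRoot (a : ℝ) (p q : Fin 2 × Fin 2) : ℂ :=
  if p.1 = q.1 then (if p.2 = q.2 then 1 else (Real.sqrt a : ℂ) * (starRingEnd ℂ) (lwdwPhase a))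
  else (if p.2 = q.2 then (Real.sqrt a : ℂ) * lwdwPhase a else -(a : ℂ))

/-- For `(a − 1)² ≤ 4a` the phase is a unit: `|w|² = 1`. [cite: LeeWeiDeWolf2017, Ex. 15 (p07)] -/
theorem normSq_lwdwPhase {a : ℝ} (ha : 0 < a) (h : (a - 1) ^ 2 ≤ 4 * a) :
    Complex.normSq (lwdwPhase a) = 1 := by
  have hsa : 0 < Real.sqrt a := Real.sqrt_pos.mpr ha
  have hc : ((a - 1) / (2 * Real.sqrt a)) ^ 2 ≤ 1 := by
    rw [div_pow, div_le_one (by positivity), mul_pow, Real.sq_sqrt ha.le]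
    linarith
  rw [lwdwPhase, Complex.normSq_mk, ← sq, ← sq, Real.sq_sqrt (by linarith)]
  ring

/-- `√a (w + w̄) = a − 1`. [cite: LeeWeiDeWolf2017, Ex. 15 (p07)] -/
theorem sqrt_mul_lwdwPhase_add_conj {a : ℝ} (ha : 0 < a) :
    (Real.sqrt a : ℂ) * (lwdwPhase a + (starRingEnd ℂ) (lwdwPhase a)) = (a : ℂ) - 1 := by
  have hsa : Real.sqrt a ≠ 0 := (Real.sqrt_pos.mpr ha).ne'
  have hre : lwdwPhase a + (starRingEnd ℂ) (lwdwPhase a) = (((a - 1) / Real.sqrt a : ℝ) : ℂ) := by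
    rw [Complex.add_conj]
    simp only [lwdwPhase]
    push_cast
    field_simp
  rw [hre, ← Complex.ofReal_mul, mul_div_cancel₀ _ hsa]
  push_cast
  ring

/-- `M ∘ M̄ = A ⊗ A`. [cite: LeeWeiDeWolf2017, Ex. 15 (p07)] -/
theorem lwdwPairTensor_eq_normSq {a : ℝ} (ha : 0 < a) (h : (a - 1) ^ 2 ≤ 4 * a) (p q : Fin 2 × Fin 2) :
    lwdwPairTensor a p q = Complex.normSq (lwdwRoot a p q) := by
  have hw := normSq_lwdwPhase ha h
  have hsq : Complex.normSq (Real.sqrt a : ℂ) = a := by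
    rw [Complex.normSq_ofReal, Real.mul_self_sqrt ha.le]
  simp only [lwdwPairTensor, lwdwPair, lwdwRoot, Matrix.of_apply]
  by_cases h1 : p.1 = q.1 <;> by_cases h2 : p.2 = q.2 <;>
    simp [h1, h2, hw, hsq, Complex.normSq_neg, Complex.normSq_ofReal]

/-- Every column of `M` sums to zero: `1 + √a w̄ + √a w − a = 0`. [cite: LeeWeiDeWolf2017, Ex. 15 (p07)] -/
theorem sum_lwdwRoot_eq_zero {a : ℝ} (ha : 0 < a) (q : Fin 2 × Fin 2) : ∑ p, lwdwRoot a p q = 0 := by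
  have key : (1 : ℂ) + (Real.sqrt a : ℂ) * (starRingEnd ℂ) (lwdwPhase a) +
      ((Real.sqrt a : ℂ) * lwdwPhase a + -(a : ℂ)) = 0 := by
    have h := sqrt_mul_lwdwPhase_add_conj ha
    linear_combination h
  obtain ⟨q1, q2⟩ := q
  rw [Fintype.sum_prod_type]
  simp only [Fin.sum_univ_two, lwdwRoot]
  fin_cases q1 <;> fin_cases q2 <;> simp <;> linear_combination key

/-- **LWdW Example 15, upper half**: for `a > 0` with `(a−1)² ≤ 4a` (which holds on the printed range
`a ∈ [√2 − 1, √2 + 1]`), `rank_psd^ℂ(A ⊗ A) ≤ 3` (Theorem 11's mechanism on the root `M`).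
[cite: LeeWeiDeWolf2017, Ex. 15 (p07)] -/
theorem hasComplexPsdFactorization_lwdwPairTensor_three {a : ℝ} (ha : 0 < a) (h : (a - 1) ^ 2 ≤ 4 * a) :
    HasComplexPsdFactorization (lwdwPairTensor a) 3 := by
  have h3 := HasComplexPsdFactorization.of_normSq_of_colSum_eq_zero (Matrix.of (lwdwRoot a))
    (fun p q => lwdwPairTensor_eq_normSq ha h p q) (sum_lwdwRoot_eq_zero ha)
  simpa using h3

/-- **LWdW Example 15, lower half**: for `a ≠ 1` (`a ≠ −1`), `rank A = 2` and hence every complex psd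
factorization of `A = [1 a; a 1]` has size `≥ 2` (Fact 4: `rank ≤ rank_psd²`).
[cite: LeeWeiDeWolf2017, Ex. 15 (p07) with Fact 4 (p05)] -/
theorem two_le_of_hasComplexPsdFactorization_lwdwPair {a : ℝ} (ha1 : a ≠ 1) (ha2 : a ≠ -1) {r : ℕ}
    (h : HasComplexPsdFactorization (lwdwPair a) r) : 2 ≤ r := by
  have hdet : (lwdwPair a).det ≠ 0 := by
    rw [Matrix.det_fin_two]
    simp only [lwdwPair, Matrix.of_apply]
    simp
    intro h0
    have : (a - 1) * (a + 1) = 0 := by linear_combination -h0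
    rcases mul_eq_zero.mp this with h1 | h1
    · exact ha1 (by linarith)
    · exact ha2 (by linarith)
  have hrank : (lwdwPair a).rank = 2 := by
    have hu : IsUnit (lwdwPair a) :=
      (Matrix.isUnit_iff_isUnit_det _).mpr (isUnit_iff_ne_zero.mpr hdet)
    simpa using Matrix.rank_of_isUnit _ hu
  have hle := h.rank_le_sq
  rw [hrank] at hle
  by_contra hr
  have : r ≤ 1 := by omega
  have : r ^ 2 ≤ 1 := by nlinarith
  omega

/-- **LWdW Example 15** (p07, verbatim: "for `a ∈ [−1+√2, 1+√2] \\ {1}` we have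
`rank_psd(A ⊗ A) < rank_psd(A)²`"): on that range `A ⊗ A` has a complex psd factorization of size
`3`, while every complex psd factorization of `A` has size `≥ 2` (so `rank_psd(A)² ≥ 4 > 3`).
[cite: LeeWeiDeWolf2017, Ex. 15 (p07)] -/
theorem LeeWeiDeWolf2017_ex15 {a : ℝ} (h1 : Real.sqrt 2 - 1 ≤ a) (h2 : a ≤ Real.sqrt 2 + 1)
    (ha1 : a ≠ 1) :
    HasComplexPsdFactorization (lwdwPairTensor a) 3 ∧
      ∀ r, HasComplexPsdFactorization (lwdwPair a) r → 2 ≤ r := by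
  have hs2 : (4 : ℝ) / 3 < Real.sqrt 2 := by
    rw [show (4 : ℝ) / 3 = Real.sqrt ((4 / 3) ^ 2) by rw [Real.sqrt_sq (by norm_num)]]
    exact Real.sqrt_lt_sqrt (by norm_num) (by norm_num)
  have hsq : Real.sqrt 2 ^ 2 = 2 := Real.sq_sqrt (by norm_num)
  have ha : 0 < a := by linarith
  have h : (a - 1) ^ 2 ≤ 4 * a := by nlinarith
  exact ⟨hasComplexPsdFactorization_lwdwPairTensor_three ha h,
    fun r hr => two_le_of_hasComplexPsdFactorization_lwdwPair ha1 (by linarith) hr⟩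

/-! ### Lemma 10 and Theorem 11 in full (appended): closing a polygon with prescribed side lengths -/

/-- Two sides: given `w` with `|w| = r`, a length `c` and a target `ρ` with the triangle inequalities
`ρ ≤ r + c`, `r ≤ ρ + c`, `c ≤ ρ + r`, there is a unit `z` with `|w + cz| = ρ` (law of cosines:
`z = ζ·w/r`, `ζ = x + i√(1−x²)`, `x = (ρ² − r² − c²)/(2rc)`). [cite: LeeWeiDeWolf2017, Lemma 10 proof (p07, the case m = 3)] -/
theorem exists_unit_normSq_add_eq (w : ℂ) {r c ρ : ℝ} (hr : 0 ≤ r) (hc : 0 ≤ c) (hρ : 0 ≤ ρ)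
    (hw : Complex.normSq w = r ^ 2) (h1 : ρ ≤ r + c) (h2 : r ≤ ρ + c) (h3 : c ≤ ρ + r) :
    ∃ z : ℂ, Complex.normSq z = 1 ∧ Complex.normSq (w + c * z) = ρ ^ 2 := by
  rcases hr.eq_or_lt with hr0 | hr0
  · -- `r = 0`: `w = 0`, `ρ = c`
    subst hr0
    have hw0 : w = 0 := Complex.normSq_eq_zero.mp (by rw [hw]; ring)
    have hρc : ρ = c := le_antisymm (by linarith) (by linarith)
    refine ⟨1, by simp, ?_⟩
    rw [hw0, zero_add, mul_one, Complex.normSq_ofReal, hρc, sq]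
  rcases hc.eq_or_lt with hc0 | hc0
  · -- `c = 0`: `ρ = r`
    subst hc0
    have hρr : ρ = r := le_antisymm (by linarith) (by linarith)
    refine ⟨1, by simp, ?_⟩
    rw [Complex.ofReal_zero, zero_mul, add_zero, hw, hρr]
  -- the generic case
  set x : ℝ := (ρ ^ 2 - r ^ 2 - c ^ 2) / (2 * r * c) with hx
  have hrc : 0 < 2 * r * c := by positivity
  have hx1 : x ^ 2 ≤ 1 := by
    have hup : ρ ^ 2 - r ^ 2 - c ^ 2 ≤ 2 * r * c := by nlinarith
    have hlo : -(2 * r * c) ≤ ρ ^ 2 - r ^ 2 - c ^ 2 := by nlinarith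
    have hxle : x ≤ 1 := by rw [hx, div_le_one hrc]; exact hup
    have hxge : -1 ≤ x := by rw [hx, le_div_iff₀ hrc]; linarith
    nlinarith
  set ζ : ℂ := ⟨x, Real.sqrt (1 - x ^ 2)⟩ with hζ
  have hζ1 : Complex.normSq ζ = 1 := by
    rw [hζ, Complex.normSq_mk, ← sq, ← sq, Real.sq_sqrt (by linarith)]
    ring
  have hr2 : Complex.normSq (r : ℂ) = r ^ 2 := by rw [Complex.normSq_ofReal, sq]
  have hrne : (r : ℂ) ≠ 0 := by exact_mod_cast hr0.ne'
  refine ⟨ζ * (w / r), ?_, ?_⟩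
  · rw [map_mul, map_div₀, hζ1, hw, hr2, one_mul, div_self (pow_ne_zero 2 hr0.ne')]
  · have hfac : w + (c : ℂ) * (ζ * (w / r)) = (w / r) * ((r : ℂ) + c * ζ) := by
      field_simp
    have hkey : Complex.normSq ((r : ℂ) + c * ζ) = ρ ^ 2 := by
      rw [hζ, show ((r : ℂ) + (c : ℂ) * (⟨x, Real.sqrt (1 - x ^ 2)⟩ : ℂ)) =
        ⟨r + c * x, c * Real.sqrt (1 - x ^ 2)⟩ by apply Complex.ext <;> simp, Complex.normSq_mk]
      have hs : Real.sqrt (1 - x ^ 2) * Real.sqrt (1 - x ^ 2) = 1 - x ^ 2 :=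
        Real.mul_self_sqrt (by linarith)
      have hxdef : 2 * r * c * x = ρ ^ 2 - r ^ 2 - c ^ 2 := by
        rw [hx, mul_div_cancel₀ _ hrc.ne']
      nlinarith [hs, hxdef]
    rw [hfac, map_mul, map_div₀, hw, hr2, div_self (pow_ne_zero 2 hr0.ne'), one_mul, hkey]

/-- **LWdW Lemma 10, quantitative form** (p07: "Suppose that `v ∈ ℝ^m` is nonnegative and has no
dominant entries. Then there exist complex units `e^{iθ_j}` such that `Σ_j v_j e^{iθ_j} = 0`"): for
nonnegative `v` and a target `ρ ≥ 0` with `ρ ≤ Σ_j v_j` and `2v_k ≤ ρ + Σ_j v_j` for all `k` (the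
polygon inequalities for the lengths `ρ, v_1, …, v_m`), there are units `z_j` with `|Σ_j v_j z_j| = ρ`
— induction on `m`, closing one side at a time (`exists_unit_normSq_add_eq` with the intermediate
target `min(ρ + v_m, Σ_{j<m} v_j)`), instead of the printed reduction to a triangle by grouping.
[cite: LeeWeiDeWolf2017, Lemma 10 (p07)] -/
theorem exists_units_normSq_sum_eq : ∀ {m : ℕ} (v : Fin m → ℝ), (∀ j, 0 ≤ v j) → ∀ (ρ : ℝ), 0 ≤ ρ →
    ρ ≤ ∑ j, v j → (∀ k, 2 * v k ≤ ρ + ∑ j, v j) →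
      ∃ z : Fin m → ℂ, (∀ j, Complex.normSq (z j) = 1) ∧
        Complex.normSq (∑ j, (v j : ℂ) * z j) = ρ ^ 2 := by
  intro m
  induction m with
  | zero =>
    intro v _ ρ hρ h1 _
    have hρ0 : ρ = 0 := le_antisymm (by simpa using h1) hρ
    exact ⟨Fin.elim0, fun j => Fin.elim0 j, by simp [hρ0]⟩
  | succ m ih =>
    intro v hv ρ hρ h1 h2
    -- split off the last side `c`
    set c : ℝ := v (Fin.last m) with hcdef
    set S : ℝ := ∑ j : Fin m, v (Fin.castSucc j) with hSdef
    have hsum : ∑ j, v j = S + c := by rw [Fin.sum_univ_castSucc]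
    have hc : 0 ≤ c := hv _
    have hS : 0 ≤ S := Finset.sum_nonneg fun j _ => hv _
    have hvS : ∀ k : Fin m, v (Fin.castSucc k) ≤ S := fun k =>
      Finset.single_le_sum (f := fun j : Fin m => v (Fin.castSucc j)) (fun j _ => hv _) (Finset.mem_univ k)
    rw [hsum] at h1 h2
    -- the intermediate target
    set ρ' : ℝ := min (ρ + c) S with hρ'def
    have hρ'0 : 0 ≤ ρ' := le_min (by linarith) hS
    obtain ⟨z', hz'1, hz'sum⟩ := ih (fun j => v (Fin.castSucc j)) (fun j => hv _) ρ' hρ'0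
      (min_le_right _ _) (fun k => by
        have hk := h2 (Fin.castSucc k)
        have := hvS k
        rcases min_cases (ρ + c) S with ⟨h, _⟩ | ⟨h, _⟩ <;> rw [hρ'def, h] <;> linarith)
    -- close the polygon with the last side
    have hlast := h2 (Fin.last m)
    obtain ⟨zl, hzl1, hzl⟩ := exists_unit_normSq_add_eq (∑ j : Fin m, (v (Fin.castSucc j) : ℂ) * z' j)
      hρ'0 hc hρ hz'sum
      (by rcases min_cases (ρ + c) S with ⟨h, _⟩ | ⟨h, _⟩ <;> rw [hρ'def, h] <;> linarith)
      (by have := min_le_left (ρ + c) S; linarith)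
      (by rcases min_cases (ρ + c) S with ⟨h, _⟩ | ⟨h, _⟩ <;> rw [hρ'def, h] <;> linarith)
    refine ⟨Fin.snoc z' zl, fun j => ?_, ?_⟩
    · rcases Fin.eq_castSucc_or_eq_last j with ⟨j, rfl⟩ | rfl
      · rw [Fin.snoc_castSucc]; exact hz'1 j
      · rw [Fin.snoc_last]; exact hzl1
    · rw [Fin.sum_univ_castSucc]
      simp only [Fin.snoc_castSucc, Fin.snoc_last]
      exact hzl

/-- **LWdW Lemma 10** (p07, verbatim): "Suppose that `v ∈ ℝ^m` is nonnegative and has no dominant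
entries. Then there exist complex units `e^{iθ_j}` such that `Σ_j v_j e^{iθ_j} = 0`." (An entry `v_k`
is dominant if `|v_k| > Σ_{j≠k} |v_j|` — Definition p07; "no dominant entry" is typed as
`v_k ≤ Σ_{j≠k} v_j` for all `k`.) [cite: LeeWeiDeWolf2017, Lemma 10 (p07)] -/
theorem LeeWeiDeWolf2017_lemma10 {m : ℕ} (v : Fin m → ℝ) (hv : ∀ j, 0 ≤ v j)
    (hdom : ∀ k, v k ≤ ∑ j ∈ Finset.univ.erase k, v j) :
    ∃ z : Fin m → ℂ, (∀ j, Complex.normSq (z j) = 1) ∧ ∑ j, (v j : ℂ) * z j = 0 := by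
  have h2 : ∀ k, 2 * v k ≤ 0 + ∑ j, v j := fun k => by
    have h := hdom k
    rw [← Finset.add_sum_erase _ _ (Finset.mem_univ k)]
    linarith
  obtain ⟨z, hz1, hz⟩ := exists_units_normSq_sum_eq v hv 0 le_rfl
    (Finset.sum_nonneg fun j _ => hv j) h2
  refine ⟨z, hz1, Complex.normSq_eq_zero.mp ?_⟩
  rw [hz]
  ring

/-- **LWdW Theorem 11** (p07, verbatim: "Let `A` be an `m`-by-`n` nonnegative matrix, and `A'` be the
entry-wise square root of `A` (so `A'` is nonnegative as well). If every column of `A'` has no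
dominant entry, then the PSD-rank of `A` is less than `m`"): under that hypothesis `A` has a complex
psd factorization of size `m − 1` (phases from Lemma 10 make every column of `M = A' ∘ e^{iθ}` sum to
zero; then `HasComplexPsdFactorization.of_normSq_of_colSum_eq_zero`, i.e. Lemma 2).
[cite: LeeWeiDeWolf2017, Thm. 11 (p07)] -/
theorem LeeWeiDeWolf2017_thm11 {m n : ℕ} (A : Matrix (Fin m) (Fin n) ℝ) (hA : ∀ i k, 0 ≤ A i k)
    (hdom : ∀ k i, Real.sqrt (A i k) ≤ ∑ j ∈ Finset.univ.erase i, Real.sqrt (A j k)) :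
    HasComplexPsdFactorization A (m - 1) := by
  have hcol : ∀ k, ∃ z : Fin m → ℂ, (∀ j, Complex.normSq (z j) = 1) ∧
      ∑ j, (Real.sqrt (A j k) : ℂ) * z j = 0 := fun k =>
    LeeWeiDeWolf2017_lemma10 (fun j => Real.sqrt (A j k)) (fun j => Real.sqrt_nonneg _) (hdom k)
  choose z hz1 hzsum using hcol
  have h := HasComplexPsdFactorization.of_normSq_of_colSum_eq_zero (A := A)
    (Matrix.of fun j k => (Real.sqrt (A j k) : ℂ) * z k j) (fun j k => by
      rw [Matrix.of_apply, map_mul, Complex.normSq_ofReal, hz1, mul_one, Real.mul_self_sqrt (hA j k)])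
    (fun k => by simpa only [Matrix.of_apply] using hzsum k)
  simpa using h

/-! ### §6.1: approximations of the identity (appended) — Theorem 43 (real form), Proposition 44 -/

/-- **LWdW Theorem 43 for the real psd rank** (p13, verbatim: "We say that an `n`-by-`n` matrix `A` is
an `ε`-approximation of the identity if `A(i,i) = 1` for all `i ∈ [n]` and `0 ≤ A(i,j) ≤ ε` for all
`i ≠ j`. [...] Theorem 43. If an `n`-by-`n` matrix `A` is an `ε`-approximation of the identity, then
`rank_psd(A) ≥ n/(1 + ε(n−1))`"; printed proof: normalise the columns to a stochastic `P`, each column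
is divided by at most `1 + ε(n−1)`, then `B₄`). Typed, like the tree's `B₄`
(`LeeWeiDeWolf2017_thm24_real`), for REAL factorizations: a real psd factorization of size `r` has
`n ≤ r (1 + ε(n−1))`. [cite: LeeWeiDeWolf2017, Thm. 43 (p13)] -/
theorem LeeWeiDeWolf2017_thm43_real {n r : ℕ} (hn : 1 ≤ n) {A : Fin n → Fin n → ℝ} {ε : ℝ} (hε : 0 ≤ ε)
    (hdiag : ∀ i, A i i = 1) (hoff : ∀ i j, i ≠ j → 0 ≤ A i j ∧ A i j ≤ ε)
    (hA : HasPsdFactorization A r) : (n : ℝ) ≤ r * (1 + ε * (n - 1)) := by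
  classical
  -- column sums `s_j ∈ [1, 1 + ε(n−1)]`
  set s : Fin n → ℝ := fun j => ∑ i, A i j with hs
  have hnn : ∀ i j, 0 ≤ A i j := fun i j => by
    by_cases h : i = j
    · rw [h, hdiag]; norm_num
    · exact (hoff i j h).1
  have hs1 : ∀ j, 1 ≤ s j := fun j => by
    have := Finset.single_le_sum (f := fun i => A i j) (fun i _ => hnn i j) (Finset.mem_univ j)
    simpa [hs, hdiag j] using this
  have hs2 : ∀ j, s j ≤ 1 + ε * (n - 1) := fun j => by
    have h : s j = A j j + ∑ i ∈ Finset.univ.erase j, A i j :=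
      (Finset.add_sum_erase _ _ (Finset.mem_univ j)).symm
    have hb : ∑ i ∈ Finset.univ.erase j, A i j ≤ ∑ _i ∈ Finset.univ.erase j, ε :=
      Finset.sum_le_sum fun i hi => (hoff i j (Finset.ne_of_mem_erase hi)).2
    rw [Finset.sum_const, Finset.card_erase_of_mem (Finset.mem_univ j), Finset.card_univ,
      Fintype.card_fin, nsmul_eq_mul] at hb
    rw [h, hdiag]
    have hcast : (((n - 1 : ℕ)) : ℝ) = (n : ℝ) - 1 := by rw [Nat.cast_sub hn, Nat.cast_one]
    rw [hcast] at hb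
    linarith
  have hspos : ∀ j, 0 < s j := fun j => lt_of_lt_of_le one_pos (hs1 j)
  -- the column-normalised stochastic matrix has a real psd factorization of the same size
  have hP : HasPsdFactorization (fun i j => 1 * A i j * (s j)⁻¹) r :=
    hA.rescale (fun _ => zero_le_one) (fun j => inv_nonneg.mpr (hspos j).le)
  have hcol : ∀ j, ∑ i, (fun i j => 1 * A i j * (s j)⁻¹) i j = 1 := fun j => by
    simp only [one_mul, ← Finset.sum_mul]
    exact mul_inv_cancel₀ (hspos j).ne'
  have hB4 := LeeWeiDeWolf2017_thm24_real hP hcol id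
  simp only [id, one_mul, hdiag] at hB4
  -- `Σ_i 1/s_i ≥ n/(1 + ε(n−1))`
  have hK : 0 < 1 + ε * (n - 1) := by
    have : (1 : ℝ) ≤ n := by exact_mod_cast hn
    nlinarith
  have hterm : ∀ i, 1 / (1 + ε * (n - 1)) ≤ (s i)⁻¹ := fun i => by
    rw [one_div]; exact inv_anti₀ (hspos i) (hs2 i)
  have hsum : (n : ℝ) / (1 + ε * (n - 1)) ≤ ∑ i, (s i)⁻¹ := by
    calc (n : ℝ) / (1 + ε * (n - 1)) = ∑ _i : Fin n, 1 / (1 + ε * (n - 1)) := by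
          rw [Finset.sum_const, Finset.card_univ, Fintype.card_fin, nsmul_eq_mul, mul_one_div]
      _ ≤ ∑ i, (s i)⁻¹ := Finset.sum_le_sum fun i _ => hterm i
  have h := hsum.trans hB4
  rwa [div_le_iff₀ hK] at h

/-- The matrix `A_ε` with ones on the diagonal and `ε` elsewhere (Proposition 44).
[cite: LeeWeiDeWolf2017, Prop. 44 (p13)] -/
def offDiagConst (n : ℕ) (ε : ℝ) : Matrix (Fin n) (Fin n) ℝ := Matrix.of fun i j => if i = j then 1 else ε

/-- **LWdW Proposition 44, "only if" direction** (p13: "If `ε ≥ 1/(n−1)²`, then by Theorem 11 the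
PSD-rank of the `n`-by-`n` matrix with ones on the diagonal and `ε` off the diagonal is not full"):
for `n ≥ 3` and `ε ≥ 1/(n−1)²`, `A_ε` has a complex psd factorization of size `n − 1` (the columns of
`√A_ε` are `(1, √ε, …, √ε)` up to order; `1` is not dominant iff `1 ≤ (n−1)√ε`, and `√ε` never is for
`n ≥ 3`). Scope note: for `n = 2` the printed sentence needs `ε ≤ 1` in addition (for `ε > 1`,
`[1 ε; ε 1]` has rank `2`, hence complex psd rank `2 = n` by Fact 4, although `ε ≥ 1/(n−1)² = 1`).
[cite: LeeWeiDeWolf2017, Prop. 44 (p13)] -/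
theorem LeeWeiDeWolf2017_prop44_notFull {n : ℕ} (hn : 3 ≤ n) {ε : ℝ} (hε0 : 0 ≤ ε)
    (hε : 1 / ((n : ℝ) - 1) ^ 2 ≤ ε) : HasComplexPsdFactorization (offDiagConst n ε) (n - 1) := by
  classical
  have hn1 : (0 : ℝ) < (n : ℝ) - 1 := by
    have : (3 : ℝ) ≤ n := by exact_mod_cast hn
    linarith
  -- `(n−1)√ε ≥ 1`
  have hsqrt : 1 ≤ ((n : ℝ) - 1) * Real.sqrt ε := by
    have h1 : 1 / ((n : ℝ) - 1) ≤ Real.sqrt ε := by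
      rw [show 1 / ((n : ℝ) - 1) = Real.sqrt (1 / ((n : ℝ) - 1) ^ 2) by
        rw [Real.sqrt_div' _ (sq_nonneg _), Real.sqrt_one, Real.sqrt_sq hn1.le]]
      exact Real.sqrt_le_sqrt hε
    have := mul_le_mul_of_nonneg_left h1 hn1.le
    rwa [mul_one_div_cancel hn1.ne'] at this
  refine LeeWeiDeWolf2017_thm11 (offDiagConst n ε) (fun i k => by
    simp only [offDiagConst, Matrix.of_apply]; split_ifs <;> linarith) fun k i => ?_
  -- the column `k` of `√A_ε`: entry `1` at `j = k`, `√ε` elsewhere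
  have hcol : ∀ j, Real.sqrt (offDiagConst n ε j k) = if j = k then 1 else Real.sqrt ε := fun j => by
    simp only [offDiagConst, Matrix.of_apply]
    split_ifs <;> simp
  simp_rw [hcol]
  have hcard : (Finset.univ.erase i).card = n - 1 := by
    rw [Finset.card_erase_of_mem (Finset.mem_univ i), Finset.card_univ, Fintype.card_fin]
  have hcast : (((n - 1 : ℕ)) : ℝ) = (n : ℝ) - 1 := by
    rw [Nat.cast_sub (by omega), Nat.cast_one]
  by_cases hik : i = k
  · subst hik
    rw [if_pos rfl]
    calc (1 : ℝ) ≤ ((n : ℝ) - 1) * Real.sqrt ε := hsqrt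
      _ = ∑ _j ∈ Finset.univ.erase i, Real.sqrt ε := by
          rw [Finset.sum_const, hcard, nsmul_eq_mul, hcast]
      _ = ∑ j ∈ Finset.univ.erase i, (if j = i then 1 else Real.sqrt ε) :=
          Finset.sum_congr rfl fun j hj => by rw [if_neg (Finset.ne_of_mem_erase hj)]
  · rw [if_neg hik]
    -- some `j₀ ∉ {i, k}` exists as `n ≥ 3`; its term alone is `√ε`
    obtain ⟨j₀, hj₀i, hj₀k⟩ : ∃ j₀ : Fin n, j₀ ≠ i ∧ j₀ ≠ k := by
      by_contra! h
      have hsub : (Finset.univ : Finset (Fin n)) ⊆ {i, k} := fun j _ => by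
        by_cases hji : j = i
        · simp [hji]
        · simp [h j hji]
      have h1 := Finset.card_le_card hsub
      have h2 := Finset.card_insert_le i ({k} : Finset (Fin n))
      rw [Finset.card_univ, Fintype.card_fin] at h1
      rw [Finset.card_singleton] at h2
      omega
    calc Real.sqrt ε = (if j₀ = k then 1 else Real.sqrt ε) := by rw [if_neg hj₀k]
      _ ≤ ∑ j ∈ Finset.univ.erase i, (if j = k then 1 else Real.sqrt ε) :=
          Finset.single_le_sum (f := fun j => if j = k then (1 : ℝ) else Real.sqrt ε)
            (fun j _ => by split_ifs <;> positivity) (Finset.mem_erase.mpr ⟨hj₀i, Finset.mem_univ _⟩)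

/-- **LWdW Proposition 44, "if" direction, for the real psd rank** (p13: "if `ε < 1/(n−1)²` then any
`ε`-approximation of the identity has full PSD-rank, by Theorem 43"): typed through
`LeeWeiDeWolf2017_thm43_real` — every REAL psd factorization of an `ε`-approximation of the identity
with `ε < 1/(n−1)²` (`n ≥ 2`) has size `≥ n` (`r ≥ n/(1 + ε(n−1)) > n − 1`).
[cite: LeeWeiDeWolf2017, Prop. 44 (p13)] -/
theorem LeeWeiDeWolf2017_prop44_full_real {n r : ℕ} (hn : 2 ≤ n) {A : Fin n → Fin n → ℝ} {ε : ℝ}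
    (hε0 : 0 ≤ ε) (hε : ε < 1 / ((n : ℝ) - 1) ^ 2) (hdiag : ∀ i, A i i = 1)
    (hoff : ∀ i j, i ≠ j → 0 ≤ A i j ∧ A i j ≤ ε) (hA : HasPsdFactorization A r) : n ≤ r := by
  have h := LeeWeiDeWolf2017_thm43_real (by omega) hε0 hdiag hoff hA
  have hn1 : (0 : ℝ) < (n : ℝ) - 1 := by
    have : (2 : ℝ) ≤ n := by exact_mod_cast hn
    linarith
  have hε' : ε * ((n : ℝ) - 1) ^ 2 < 1 := by
    have := (lt_div_iff₀ (by positivity : (0 : ℝ) < ((n : ℝ) - 1) ^ 2)).mp hε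
    linarith
  by_contra hlt
  have hr : (r : ℝ) ≤ (n : ℝ) - 1 := by
    have : r + 1 ≤ n := by omega
    have : ((r + 1 : ℕ) : ℝ) ≤ n := by exact_mod_cast this
    push_cast at this
    linarith
  have hK : 0 ≤ 1 + ε * ((n : ℝ) - 1) := by nlinarith
  have : (n : ℝ) ≤ ((n : ℝ) - 1) * (1 + ε * ((n : ℝ) - 1)) := h.trans (by nlinarith)
  nlinarith

/-- **LWdW Proposition 45** (p13, verbatim: "Let `m` divide `n` and consider the `m`-by-`m` matrix `B`
where `B(i,i) = 1` and `B(i,j) = 1/(m−1)²`. Then `A = I_{n/m} ⊗ B` is an `ε`-approximation of the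
identity, and `rank_psd(A) ≤ n − n/m`, where `ε = 1/(m−1)²`"; proof: Lemma 12 and `rank_psd(B) = m−1`).
Typed with `n/m = k` blocks, `A` indexed by `[k] × [m]` as in Lemma 12, for `m ≥ 3`: a complex psd
factorization of `I_k ⊗ B` of size `k(m−1) = n − n/m` (`HasComplexPsdFactorization.kronecker` with the
size-`k` factorization of `I_k` and Proposition 44's size-`(m−1)` factorization of `B`).
[cite: LeeWeiDeWolf2017, Prop. 45 (p13)] -/
theorem LeeWeiDeWolf2017_prop45 (k : ℕ) {m : ℕ} (hm : 3 ≤ m) :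
    HasComplexPsdFactorization
      (fun p q : Fin k × Fin m => (if p.1 = q.1 then (1 : ℝ) else 0) *
        offDiagConst m (1 / ((m : ℝ) - 1) ^ 2) p.2 q.2) (k * (m - 1)) := by
  classical
  have hI : HasComplexPsdFactorization (fun i j : Fin k => if i = j then (1 : ℝ) else 0) k := by
    have h := (HasPsdFactorization.of_entry_nonneg_card_rows
      (M := fun i j : Fin k => if i = j then (1 : ℝ) else 0) (fun i j => by split_ifs <;> norm_num)).toComplex
    rwa [Fintype.card_fin] at h
  exact hI.kronecker (LeeWeiDeWolf2017_prop44_notFull hm (by positivity) le_rfl)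

end Literature.Combinatorics.Optimization
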